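import Summits.CriticalPhenomena.CardyFormulaZ2.Theorems.CardyGluingRDEContractionGivesMerging
import Summits.CriticalPhenomena.CardyFormulaZ2.Theorems.CardyGluingRDEMergingGivesPolygonCardy

/-!
# Route `CardyGluingRDE`, item `Assembly` (stmt-CriticalPhenomena-14373): what it reduces to

The item is the frame implication `Assembly : GluingContraction → CardyFormulaZ2` (thesis `X` →
sub-problem statement), i.e. the WHOLE glue of the line.  It is not a hypothesis of the route's
deciding theorem `closes hX h₁ h₂ h₃` (whose glue hypotheses are the three support items
`h₁ : ContractionGivesMerging`, `h₂ : MergingGivesPolygonCardy`, `h₃ : PolygonReduction`), but their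
composite.  Of the three, `ContractionGivesMerging` is a theorem of the tree
(`ContractionGivesMerging_proof`, pure real analysis), so:

* `Assembly_of_glue` — `MergingGivesPolygonCardy → PolygonReduction → Assembly`: the item closes by
  this one-liner as soon as items stmt-CriticalPhenomena-8584 and stmt-CriticalPhenomena-4784 land;
* `Assembly_iff_glue_of_gluingContraction` — conversely, ON THE THESIS `X` the item is EQUIVALENT to
  the conjunction of those two open items (both follow from `CardyFormulaZ2`, which `Assembly`
  yields from `X`); so no proof of the item avoiding them exists unless `X` is refuted;
* `Assembly_of_transfer` — the sharper residual: the polyomino-transfer interface `hT` of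
  `MergingGivesPolygonCardy_of_transfer` (shadowing of lattice-polyomino crossing probabilities by
  the square-boundary laws, the crux-sized content of stmt-8584) together with `PolygonReduction`
  already gives the item;
* `Assembly_of_cardyFormulaZ2`, `closes_of_assembly` — the item follows from the conjunct (so it is
  irrefutable short of `¬ CardyFormulaZ2 ∧ GluingContraction`), and together with the thesis it
  alone decides the sub-problem (the deciding theorem factors as `closes hX h₁ h₂ h₃ =
  closes_of_assembly hX (Assembly_of_glue h₂ h₃)` up to the proof of `h₁`).

No percolation input is used here; the mathematics of the glue lives in the two open items.
-/

namespace Summit.CriticalPhenomena.CardyFormulaZ2.Theorems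

open Literature.Probability.Percolation Literature.Probability.RandomPlanarGeometry
open Summit.CriticalPhenomena.CardyFormulaZ2.Theses.CardyGluingRDE

/-- **The item from the two open glue items.** `MergingGivesPolygonCardy → PolygonReduction →
Assembly`, through the proved `ContractionGivesMerging_proof`:
`X ↦ PolygonReduction (MergingGivesPolygonCardy (ContractionGivesMerging X))`. [folklore] -/
theorem Assembly_of_glue (h₂ : MergingGivesPolygonCardy) (h₃ : PolygonReduction) : Assembly :=
  fun hX => h₃ (h₂ (ContractionGivesMerging_proof hX))

/-- **The item follows from the conjunct** (`B → (A → B)`): a refutation of `Assembly` would be a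
proof of `GluingContraction ∧ ¬ CardyFormulaZ2`. [folklore] -/
theorem Assembly_of_cardyFormulaZ2 (h : _root_.CardyFormulaZ2) : Assembly :=
  fun _ => h

/-- **The item and the thesis decide the sub-problem**: `GluingContraction → Assembly →
CardyFormulaZ2` (modus ponens) — the deciding theorem of the route factors through the item,
`closes hX h₁ h₂ h₃ = closes_of_assembly hX (Assembly_of_glue h₂ h₃)`. [folklore] -/
theorem closes_of_assembly (hX : GluingContraction) (hA : Assembly) : _root_.CardyFormulaZ2 :=
  hA hX

/-- **On the thesis, the item IS the conjunction of the two open glue items.** Assuming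
`GluingContraction`: `Assembly ↔ (MergingGivesPolygonCardy ∧ PolygonReduction)` — forward because
`Assembly` then yields `CardyFormulaZ2`, which contains `CardyLatticePolygon` (lattice polyominoes
are conformal rectangles) and hence both implications; backward by `Assembly_of_glue`.  So every
proof of the item is, on `X`, a proof of stmt-CriticalPhenomena-8584 and stmt-CriticalPhenomena-4784.
[folklore] -/
theorem Assembly_iff_glue_of_gluingContraction (hX : GluingContraction) :
    Assembly ↔ (MergingGivesPolygonCardy ∧ PolygonReduction) := by
  refine ⟨fun hA => ?_, fun h => Assembly_of_glue h.1 h.2⟩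
  have hC : _root_.CardyFormulaZ2 := hA hX
  exact ⟨MergingGivesPolygonCardy_of_cardyFormulaZ2 hC, fun _ => hC⟩

/-- **The sharper residual.** The polyomino-transfer interface `hT` of
`MergingGivesPolygonCardy_of_transfer` (for every lattice-polyomino conformal rectangle `R` and
`ε > 0`, closeness in total variation of the bond-`ℤ²` and site-`𝕋` laws of the resolution-`j`
boundary-segment matrix of the square `(0, δ₀)²`, at some resolution `j`, forces
`|bondDomainCrossingProb R u - triDomainCrossingProb R u'| ≤ ε` for all small meshes; its `let`s are
those of `BoxMerging`, verbatim) together with `PolygonReduction` proves the item: `X` gives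
`BoxMerging` (`ContractionGivesMerging_proof`), the transfer and Smirnov's theorem on `𝕋` give
`CardyLatticePolygon` (`MergingGivesPolygonCardy_of_transfer`), and `PolygonReduction` the conjunct.
[folklore] -/
theorem Assembly_of_transfer
    (hT :
      let PZ := Literature.Probability.Percolation.bondPercolation
        (Literature.Probability.LatticeModels.zdGraph 2) Literature.Probability.Percolation.half
      let PT := Literature.Probability.LatticeModels.triSitePercolation
        Literature.Probability.Percolation.half
      let Sq : ℝ → Set ℂ := fun δ₀ => {z : ℂ | 0 < z.re ∧ z.re < δ₀ ∧ 0 < z.im ∧ z.im < δ₀}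
      let seg : (δ₀ : ℝ) → (j : ℕ) → Fin 4 × Fin (2 ^ j) → Set ℂ := fun δ₀ j a =>
        {z : ℂ | (a.1 = 0 ∧ z.im = 0 ∧ δ₀ * ((a.2 : ℕ) : ℝ) / 2 ^ j ≤ z.re ∧
            z.re ≤ δ₀ * (((a.2 : ℕ) : ℝ) + 1) / 2 ^ j) ∨
          (a.1 = 1 ∧ z.re = δ₀ ∧ δ₀ * ((a.2 : ℕ) : ℝ) / 2 ^ j ≤ z.im ∧
            z.im ≤ δ₀ * (((a.2 : ℕ) : ℝ) + 1) / 2 ^ j) ∨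
          (a.1 = 2 ∧ z.im = δ₀ ∧ δ₀ * ((a.2 : ℕ) : ℝ) / 2 ^ j ≤ z.re ∧
            z.re ≤ δ₀ * (((a.2 : ℕ) : ℝ) + 1) / 2 ^ j) ∨
          (a.1 = 3 ∧ z.re = 0 ∧ δ₀ * ((a.2 : ℕ) : ℝ) / 2 ^ j ≤ z.im ∧
            z.im ≤ δ₀ * (((a.2 : ℕ) : ℝ) + 1) / 2 ^ j)}
      let EZ : (δ₀ : ℝ) → (j : ℕ) → ℝ → ((Fin 4 × Fin (2 ^ j)) → (Fin 4 × Fin (2 ^ j)) → Bool) →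
          Set (Literature.Probability.Percolation.BondConfig
            (Literature.Probability.LatticeModels.Site 2)) := fun δ₀ j u M =>
        {ω | ∀ a b, ω ∈ Literature.Probability.Percolation.discreteCrossing (Sq δ₀) u (seg δ₀ j a)
          (seg δ₀ j b) ↔ M a b = true}
      let ET : (δ₀ : ℝ) → (j : ℕ) → ℝ → ((Fin 4 × Fin (2 ^ j)) → (Fin 4 × Fin (2 ^ j)) → Bool) →
          Set (Literature.Probability.Percolation.SiteConfig
            (Literature.Probability.LatticeModels.Site 2)) := fun δ₀ j u M =>
        {ω | ∀ a b, ω ∈ Literature.Probability.LatticeModels.triCrossing (Sq δ₀) u (seg δ₀ j a)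
          (seg δ₀ j b) ↔ M a b = true}
      let TV : ℝ → ℕ → ℝ → ℝ → ℝ := fun δ₀ j u u' => (1 / 2 : ℝ) *
        ∑ M : (Fin 4 × Fin (2 ^ j)) → (Fin 4 × Fin (2 ^ j)) → Bool,
          |PZ.real (EZ δ₀ j u M) - PT.real (ET δ₀ j u' M)|
      ∀ R : ConformalRectangle, ∀ δ₀ : ℝ, 0 < δ₀ →
        (∃ s : Finset (ℤ × ℤ), R.carrier = interior (⋃ p ∈ s, {z : ℂ | δ₀ * (p.1 : ℝ) ≤ z.re ∧
          z.re ≤ δ₀ * ((p.1 : ℝ) + 1) ∧ δ₀ * (p.2 : ℝ) ≤ z.im ∧ z.im ≤ δ₀ * ((p.2 : ℝ) + 1)})) →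
        (∀ i, ∃ m n : ℤ, R.pt i = (δ₀ : ℂ) * ((m : ℂ) + (n : ℂ) * Complex.I)) →
        ∀ ε : ℝ, 0 < ε → ∃ j : ℕ, ∃ η' : ℝ, 0 < η' ∧ ∃ η : ℝ, 0 < η ∧ ∀ u u' : ℝ,
          0 < u → u < η → 0 < u' → u' < η → TV δ₀ j u u' ≤ η' →
          |bondDomainCrossingProb R u - triDomainCrossingProb R u'| ≤ ε)
    (h₃ : PolygonReduction) : Assembly :=
  Assembly_of_glue (MergingGivesPolygonCardy_of_transfer hT) h₃

end Summit.CriticalPhenomena.CardyFormulaZ2.Theorems
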